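import Mathlib
import HarnessLib
import Summits.ValiantsHypothesis.ValiantsHypothesis.Theses.MonotoneRestoration
import Literature.Computability.AlgebraicComplexity.ArithCircuit
import Literature.Computability.AlgebraicComplexity.ArithCircuitProofs
import Literature.Computability.AlgebraicComplexity.MonotoneStructure
import Literature.Computability.AlgebraicComplexity.PermanentIrreducible
import Literature.ModelTheory.FiniteModelTheory.CkEquiv
import Summits.ValiantsHypothesis.ValiantsHypothesis.Theorems.MonotoneRestorationMonotoneRestorationQPCosetCount
import Summits.ValiantsHypothesis.ValiantsHypothesis.Theorems.MonotoneRestorationMonotoneRestorationQPSymmetricLB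
import Summits.ValiantsHypothesis.ValiantsHypothesis.Theorems.MonotoneRestorationMonotoneRestorationQPSupportSymmetrisation
import Summits.ValiantsHypothesis.ValiantsHypothesis.Theorems.MonotoneRestorationMonotoneRestorationQPSparseRegime
import Summits.ValiantsHypothesis.ValiantsHypothesis.Theorems.MonotoneRestorationMonotoneRestorationQPBeta
import Literature.Computability.AlgebraicComplexity.SymmetricArithCircuit
import Literature.Computability.AlgebraicComplexity.DawarWilsenach2025Proofs
import Literature.GroupTheory.PermutationGroups.SmallIndexSubgroups
import Summits.ValiantsHypothesis.ValiantsHypothesis.Theorems.MonotoneRestorationQP.Negative.LoadBearing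
import Summits.ValiantsHypothesis.ValiantsHypothesis.Theorems.MonotoneRestorationMonotoneRestorationQPPermSupportCount

/-! TTRL-lite variant V20075 of stmt-ValiantsHypothesis-15886

Variant `lemma_proposal` (have-step `gamma_sum_mem_support_prod`): no cancellation in products
over `NNReal` — if `ν h ∈ (p h).support` for every `h ∈ s`, then `∑ h ∈ s, ν h` lies in the
support of `∏ h ∈ s, p h`. Proof: `Finset.induction_on` with the two-factor lemma
`Literature.Computability.AlgebraicComplexity.add_mem_support_mul`.
-/

-- `Summit.ValiantsHypothesis.ValiantsHypothesis.…` is the tree's mandated single-conjunct layout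
-- (Sub = Summit), so the duplicated namespace component is intended.
set_option linter.dupNamespace false

namespace Summit.ValiantsHypothesis.ValiantsHypothesis.Theorems

open Summit.ValiantsHypothesis.ValiantsHypothesis.Theses.MonotoneRestoration
open Literature.Computability.AlgebraicComplexity

/-- No cancellation in products over `ℝ≥0`: if `ν h` is a monomial of `p h` for every `h ∈ s`,
then `∑ h ∈ s, ν h` is a monomial of `∏ h ∈ s, p h`. (TTRL-lite variant V20075 of
stmt-ValiantsHypothesis-15886; Finset induction on `add_mem_support_mul`.) -/
theorem symmetricMonotone_var20075 :
    ∀ (n : ℕ) (G : Type) (s : Finset G) (p : G → MvPolynomial (Fin n × Fin n) NNReal)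
      (ν : G → (Fin n × Fin n →₀ ℕ)),
      (∀ h ∈ s, ν h ∈ (p h).support) → ∑ h ∈ s, ν h ∈ (∏ h ∈ s, p h).support := by
  intro n G s p ν
  classical
  induction s using Finset.induction_on with
  | empty =>
    intro _
    simp only [Finset.sum_empty, Finset.prod_empty, MvPolynomial.mem_support_iff,
      MvPolynomial.coeff_zero_one, ne_eq, one_ne_zero, not_false_eq_true]
  | insert a s ha ih =>
    intro hs
    rw [Finset.sum_insert ha, Finset.prod_insert ha]
    exact add_mem_support_mul (hs a (Finset.mem_insert_self a s))
      (ih fun h hh => hs h (Finset.mem_insert_of_mem hh))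

end Summit.ValiantsHypothesis.ValiantsHypothesis.Theorems
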